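import Summits.Schanuel.Schanuel.Theorems.RoyCriterionSchanuelTwoStubLogRichSector
import Summits.Schanuel.Schanuel.Theorems.RoyCriterionSchanuelTwoStubGridRichSector
import Summits.Schanuel.Schanuel.Theorems.RoyCriterionRoyThesisTypedLemniscateTriple

-- `Summit.Schanuel.Schanuel.…` is the mandated layout of this single-problem summit (CONVENTIONS §1).
set_option linter.dupNamespace false

/-!
# Crux triage r2, triager 2 — crux stmt-Schanuel-0463 (`RoyCriterion.RoyThesisTyped` = `∀ n, RoyCriterion n`)

Kernel-checked evidence for TRIAGE-r2-2.md (refuter-cruxtri-stmt-Schanuel-0463-r2-2-0, 2026-08-16).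
Finding: as of this triage BOTH round-2 cards are corollaries of theorems ALREADY LANDED under
`Summits/Schanuel/Schanuel/Theorems/` — so neither has anything left for a crux-plan seat or a line
lead on this crux (and neither claims a Transfer to the crux: `RoyThesisTyped ↔ Schanuel`,
`RoyThesisTyped.crux_iff_pointwise`).

* §0 the cards' common vocabulary `RoyCriterionAt`, and `crux ↔ ∀ l y, LinearIndependent ℚ y →
  RoyCriterionAt y`; `RoyCriterionAt y ↔ l ≤ trdeg ℚ(y, e^y)` IS the landed
  `RoyThesisTyped.royCriterionAt_iff_le_trdeg` (p95942, `RoyCriterionRoyThesisTypedPointwise.lean`).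
* §1 card `frequency-companion-sector`: its First lemma `two_le_trdeg_of_bwCompanion` (verbatim
  signature) is a 40-line instance of the landed `Theorems.stub_logRichSector` (p98157, crux
  `SchanuelTwo` line `CardA_BW`: the Brownawell–Waldschmidt log-rich sector) with
  `l₁ = x₀·y 0, l₂ = x₀·y 1, μ = x₀⁻¹`; its Roy-format corollary `royCriterionAt_of_bwCompanion`
  follows by §0; its `two_le_trdeg_of_grid` ("any d×ℓ grid with dℓ > d+ℓ anchored in K^alg, y of
  ANY rank") is the landed `Theorems.stub_gridRichSector` (p98594) with the two coordinates of `x`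
  replaced by an arbitrary generating set `S` — same 12-line proof (`two_le_trdeg_adjoin_of_grid`).
* §2 card `cm-tau-companion-rank-three`: every statement in its First-lemma box is a tree theorem by
  `exact` (p96389 `RoyCriterionRoyThesisTypedRankThreeCMGamma.lean`, p102129
  `RoyCriterionRoyThesisTypedLemniscateTriple.lean` — landed by line lead a1 executing this very card).

No `sorry`; no new definitions except the cards' own `RoyCriterionAt` abbreviation.
-/

noncomputable section

open Complex IntermediateField
open Literature.NumberTheory.Transcendental

namespace Summit.Schanuel.Schanuel.Cruxes.RoyThesisTyped.TriageR2K2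

/-! ### §0 The cards' pointwise format -/

/-- Both cards' `RoyCriterionAt` (verbatim): Roy's Conjecture 2 AT the tuple `y`. -/
def RoyCriterionAt {l : ℕ} (y : Fin l → ℂ) : Prop :=
  ∀ α : Fin l → ℂ, (∀ j, α j ≠ 0) → ∀ (s₀ s₁ t₀ t₁ u : ℝ), RoyAdmissible s₀ s₁ t₀ t₁ u →
    RoyHypothesis y α s₀ s₁ t₀ t₁ u →
      (l : Cardinal) ≤ Algebra.trdeg ℚ ↥(adjoin ℚ (Set.range y ∪ Set.range α))

/-- Card 2's `royCriterionAt_of_le_trdeg` / card 1's `le_trdeg_adjoin_of_royHypothesis`, as an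
iff: this IS the landed `RoyThesisTyped.royCriterionAt_iff_le_trdeg` (p95942). -/
theorem royCriterionAt_iff {l : ℕ} (y : Fin l → ℂ) :
    RoyCriterionAt y ↔
      (l : Cardinal) ≤ Algebra.trdeg ℚ ↥(adjoin ℚ (Set.range y ∪ Set.range (cexp ∘ y))) :=
  Summit.Schanuel.Schanuel.Theorems.RoyThesisTyped.royCriterionAt_iff_le_trdeg y

/-- Cards' `crux_iff_forall_at` / `royCriterion_iff_forall_at`: binder shuffle. -/
theorem crux_iff_forall_at :
    Summit.Schanuel.Schanuel.Theses.RoyCriterion.RoyThesisTyped ↔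
      ∀ (l : ℕ) (y : Fin l → ℂ), LinearIndependent ℚ y → RoyCriterionAt y := by
  unfold Summit.Schanuel.Schanuel.Theses.RoyCriterion.RoyThesisTyped RoyCriterion RoyCriterionAt
  exact ⟨fun h l y hy α hα s₀ s₁ t₀ t₁ u hadm hhyp => h l y α hy hα s₀ s₁ t₀ t₁ u hadm hhyp,
    fun h l y α hy hα s₀ s₁ t₀ t₁ u hadm hhyp => h l y hy α hα s₀ s₁ t₀ t₁ u hadm hhyp⟩

/-! ### §1 Card `frequency-companion-sector` ⊂ landed `stub_logRichSector` / `stub_gridRichSector` -/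

/-- **Card 1's First lemma, verbatim signature** (`two_le_trdeg_of_bwCompanion`): a `𝔾ₘ`-companion
frequency `x₀ ∉ ℚ`, algebraic over `K = ℚ(y, e^y)`, with `e^{x₀ y₀}, e^{x₀ y₁} ∈ ℚ̄`, forces
`2 ≤ trdeg K`. Proof: the LANDED B–W log-rich sector `Theorems.stub_logRichSector` (p98157) with
`l₁ = x₀ y₀`, `l₂ = x₀ y₁`, `μ = x₀⁻¹` (`μ lⱼ = yⱼ`, `e^{μ lⱼ} = e^{yⱼ} ∈ K`).
[cite: BakerTNT1975, Ch. 12 Theorem 12.2] -/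
theorem two_le_trdeg_of_bwCompanion (y : Fin 2 → ℂ) (hy : LinearIndependent ℚ y) (x₀ : ℂ)
    (hx₀ : x₀ ∉ Set.range (algebraMap ℚ ℂ))
    (halg : IsAlgebraic ↥(adjoin ℚ (Set.range y ∪ Set.range (cexp ∘ y))) x₀)
    (h0 : IsAlgebraic ℚ (cexp (x₀ * y 0))) (h1 : IsAlgebraic ℚ (cexp (x₀ * y 1))) :
    (2 : Cardinal) ≤ Algebra.trdeg ℚ ↥(adjoin ℚ (Set.range y ∪ Set.range (cexp ∘ y))) := by
  set K : IntermediateField ℚ ℂ := adjoin ℚ (Set.range y ∪ Set.range (cexp ∘ y)) with hK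
  have hx0 : x₀ ≠ 0 := by
    rintro rfl
    exact hx₀ ⟨0, by simp⟩
  have hyK : ∀ j, y j ∈ K := fun j => subset_adjoin ℚ _ (Or.inl ⟨j, rfl⟩)
  have heK : ∀ j, cexp (y j) ∈ K := fun j => subset_adjoin ℚ _ (Or.inr ⟨j, rfl⟩)
  have halgK : ∀ {z : ℂ}, z ∈ K → IsAlgebraic K z := fun hz =>
    isAlgebraic_algebraMap (⟨_, hz⟩ : K)
  have hl : ∀ j, IsAlgebraic K (x₀ * y j) := fun j => halg.mul (halgK (hyK j))
  have hμ : IsAlgebraic K x₀⁻¹ := halg.inv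
  have hml : ∀ j, cexp (x₀⁻¹ * (x₀ * y j)) = cexp (y j) := by
    intro j
    rw [← mul_assoc, inv_mul_cancel₀ hx0, one_mul]
  have hy' : ∀ s t : ℚ, s • y 0 + t • y 1 = 0 → s = 0 ∧ t = 0 := by
    have h := hy
    rw [show y = ![y 0, y 1] from by funext j; fin_cases j <;> rfl] at h
    exact LinearIndependent.pair_iff.mp h
  have hli : LinearIndependent ℚ ![x₀ * y 0, x₀ * y 1] := by
    refine LinearIndependent.pair_iff.mpr fun s t hst => hy' s t ?_
    have hmul : x₀ * (s • y 0 + t • y 1) = 0 := by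
      simp only [Rat.smul_def] at hst ⊢
      linear_combination hst
    rcases mul_eq_zero.mp hmul with h | h
    · exact absurd h hx0
    · exact h
  have hirr : LinearIndependent ℚ ![(1 : ℂ), x₀⁻¹] := by
    refine LinearIndependent.pair_iff.mpr fun s t hst => ?_
    simp only [Rat.smul_def, mul_one] at hst
    by_cases ht : t = 0
    · subst ht
      refine ⟨?_, rfl⟩
      have h' : (s : ℂ) = 0 := by simpa using hst
      exact_mod_cast h'
    · exfalso
      have h2 : (s : ℂ) * x₀ + (t : ℂ) = 0 := by
        have := congrArg (· * x₀) hst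
        simpa only [add_mul, zero_mul, inv_mul_cancel_right₀ hx0] using this
      have hs : (s : ℂ) ≠ 0 := by
        intro hs
        rw [hs, zero_mul, zero_add] at h2
        exact ht (by exact_mod_cast h2)
      apply hx₀
      refine ⟨-t / s, ?_⟩
      rw [map_div₀, map_neg, div_eq_iff (by simpa using hs)]
      simp only [eq_ratCast]
      linear_combination -h2
  have hm0 : IsAlgebraic K (cexp (x₀⁻¹ * (x₀ * y 0))) := by rw [hml]; exact halgK (heK 0)
  have hm1 : IsAlgebraic K (cexp (x₀⁻¹ * (x₀ * y 1))) := by rw [hml]; exact halgK (heK 1)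
  exact Summit.Schanuel.Schanuel.Theorems.stub_logRichSector y (x₀ * y 0) (x₀ * y 1) x₀⁻¹ h0 h1
    hli hirr (hl 0) (hl 1) hμ hm0 hm1

/-- Card 1's Roy-format corollary `royCriterionAt_of_bwCompanion`: §1 + the landed pointwise
transfer (p95942). [cite: Roy2001, Conjecture 2] -/
theorem royCriterionAt_of_bwCompanion (y : Fin 2 → ℂ) (hy : LinearIndependent ℚ y) (x₀ : ℂ)
    (hx₀ : x₀ ∉ Set.range (algebraMap ℚ ℂ))
    (halg : IsAlgebraic ↥(adjoin ℚ (Set.range y ∪ Set.range (cexp ∘ y))) x₀)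
    (h0 : IsAlgebraic ℚ (cexp (x₀ * y 0))) (h1 : IsAlgebraic ℚ (cexp (x₀ * y 1))) :
    RoyCriterionAt y :=
  (royCriterionAt_iff y).mpr (by exact_mod_cast two_le_trdeg_of_bwCompanion y hy x₀ hx₀ halg h0 h1)

/-- Card 1's `two_le_trdeg_of_grid` for a field `ℚ(S)` with `S` ARBITRARY (so "y of ANY rank"):
a `ℚ`-free `X : Fin d`, a `ℚ`-free `Y : Fin ℓ` with `ℓ + d < dℓ`, and all `e^{XᵢYⱼ}`, algebraic over
`ℚ(S)`, force `2 ≤ trdeg ℚ(S)`. This is the landed `Theorems.stub_gridRichSector` (p98594) with its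
12-line proof copied for a general generating set; card 1's cubic self-similar points
(`X = (1, β, β²)`, `Y = (λ, βλ)`, `d = 3`, `ℓ = 2`, `5 < 6`) and its `two_le_trdeg_of_companions`
(`d ≥ 3`) are instances. [cite: NesterenkoPhilippon2001, Ch. 14 Theorem 2.9] -/
theorem two_le_trdeg_adjoin_of_grid (S : Set ℂ) {d l : ℕ} (X : Fin d → ℂ) (Y : Fin l → ℂ)
    (hdl : l + d < d * l) (hX : LinearIndependent ℚ X) (hY : LinearIndependent ℚ Y)
    (hXa : ∀ i, IsAlgebraic ↥(adjoin ℚ S) (X i)) (hYa : ∀ j, IsAlgebraic ↥(adjoin ℚ S) (Y j))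
    (hE : ∀ i j, IsAlgebraic ↥(adjoin ℚ S) (cexp (X i * Y j))) :
    (2 : Cardinal) ≤ Algebra.trdeg ℚ ↥(adjoin ℚ S) := by
  set T : Set ℂ :=
    Set.range X ∪ Set.range Y ∪ Set.range (fun p : Fin d × Fin l => cexp (X p.1 * Y p.2))
  have hT : ∀ z ∈ T, IsAlgebraic (adjoin ℚ S) z := by
    rintro z ((⟨i, rfl⟩ | ⟨j, rfl⟩) | ⟨⟨i, j⟩, rfl⟩)
    exacts [hXa i, hYa j, hE i j]
  have hle : Literature.Barriers.Schanuel.gridField₂ X Y ≤ adjoin ℚ (S ∪ T) := by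
    unfold Literature.Barriers.Schanuel.gridField₂
    exact adjoin.mono ℚ _ _ Set.subset_union_right
  calc (2 : Cardinal) ≤ Algebra.trdeg ℚ (Literature.Barriers.Schanuel.gridField₂ X Y) :=
        Literature.Barriers.Schanuel.two_le_trdeg_gridField₂ X Y hX hY hdl
    _ ≤ Algebra.trdeg ℚ (adjoin ℚ (S ∪ T)) := Literature.Barriers.Schanuel.trdeg_mono hle
    _ = Algebra.trdeg ℚ (adjoin ℚ S) :=
        Literature.Barriers.Schanuel.trdeg_adjoin_union_eq_of_isAlgebraic_adjoin S T hT

/-- The rank-2 case in the crux's variables is LITERALLY the landed stub. -/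
example : ∀ (x : Fin 2 → ℂ) (d l : ℕ) (X : Fin d → ℂ) (Y : Fin l → ℂ), l + d < d * l →
    LinearIndependent ℚ X → LinearIndependent ℚ Y →
    (∀ i, IsAlgebraic ↥(adjoin ℚ (Set.range x ∪ Set.range (Complex.exp ∘ x))) (X i)) →
    (∀ j, IsAlgebraic ↥(adjoin ℚ (Set.range x ∪ Set.range (Complex.exp ∘ x))) (Y j)) →
    (∀ i j, IsAlgebraic ↥(adjoin ℚ (Set.range x ∪ Set.range (Complex.exp ∘ x)))
      (Complex.exp (X i * Y j))) →
    (2 : Cardinal) ≤ Algebra.trdeg ℚ ↥(adjoin ℚ (Set.range x ∪ Set.range (Complex.exp ∘ x))) :=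
  Summit.Schanuel.Schanuel.Theorems.stub_gridRichSector

/-! ### §2 Card `cm-tau-companion-rank-three` = landed p96389 / p102129 (its own salvage) -/

/-- Card 2 `three_le_trdeg_SF_of_pi_gamma` — tree, by `exact`. -/
example {l : ℕ} (y : Fin l → ℂ) (i j : Fin l) (hi : y i = Real.pi)
    (hj : y j = Real.Gamma (1 / 4)) :
    (3 : Cardinal) ≤ Algebra.trdeg ℚ ↥(adjoin ℚ (Set.range y ∪ Set.range (cexp ∘ y))) :=
  Summit.Schanuel.Schanuel.Theorems.RoyThesisTyped.three_le_trdeg_of_pi_gammaQuarter y i j hi hj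

/-- Card 2 `royCriterionAt_three_of_pi_gamma` — tree, by `exact`. -/
example (y : Fin 3 → ℂ) (i j : Fin 3) (hi : y i = Real.pi) (hj : y j = Real.Gamma (1 / 4)) :
    RoyCriterionAt y := fun α hα s₀ s₁ t₀ t₁ u hadm hhyp =>
  Summit.Schanuel.Schanuel.Theorems.RoyThesisTyped.royCriterion_three_on_cmGammaSector y α
    ⟨i, j, hi, hj⟩ hα s₀ s₁ t₀ t₁ u hadm hhyp

/-- Card 2 `linearIndependent_cmGammaTriple` — tree, by `exact`. -/
example : LinearIndependent ℚ ![(Real.pi : ℂ) * I, (Real.pi : ℂ), (Real.Gamma (1 / 4) : ℂ)] :=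
  Summit.Schanuel.Schanuel.Theorems.RoyThesisTyped.linearIndependent_piI_pi_gammaQuarter

/-- Card 2 `royCriterionAt_cmGammaTriple` (flagship `(πi, π, Γ(1/4))`) — tree, by `exact`. -/
example : RoyCriterionAt ![(Real.pi : ℂ) * I, (Real.pi : ℂ), (Real.Gamma (1 / 4) : ℂ)] :=
  Summit.Schanuel.Schanuel.Theorems.RoyThesisTyped.royCriterion_three_at_piI_pi_gammaQuarter.2

/-- Card 2 `royCriterionAt_lemniscateTriple` (`(ϖ, iϖ, π)`, `ϖ = Γ(1/4)²/(2√(2π))`) — tree. -/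
example (ϖ : ℝ) (hϖ : ϖ = Real.Gamma (1 / 4) ^ 2 / (2 * Real.sqrt (2 * Real.pi))) :
    LinearIndependent ℚ ![(ϖ : ℂ), (ϖ : ℂ) * I, (Real.pi : ℂ)] ∧
      RoyCriterionAt ![(ϖ : ℂ), (ϖ : ℂ) * I, (Real.pi : ℂ)] :=
  Summit.Schanuel.Schanuel.Theorems.RoyThesisTyped.royCriterion_three_at_lemniscateTriple ϖ hϖ

end Summit.Schanuel.Schanuel.Cruxes.RoyThesisTyped.TriageR2K2

end
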